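import Summits.Ventures.CertifiedManyBodySolver.Theorems.TcThermcert1FreeCanonicalSingleSiteTimeReversal
import Summits.Ventures.CertifiedManyBodySolver.Theorems.TcThermcert1FreeCanonicalRungReduction
import Summits.Ventures.CertifiedManyBodySolver.Theorems.TcThermcert1QbpSectorBookkeeping
import HarnessLib

/-!
# Free canonical gas at `β·t = 8` — the sub-extensive ladder `R(s)` for every `s ≤ 0` (in particular `R(0)`), by time reversal

Helper file for route `TcThermcert1` (crux K1′ `ThermalStiffnessCeilingU8b8_le_7o44`, item `stmt-Ventures-24560`), crux idea
`free-canonical-b8-rung` (sketch `Cruxes/ThermalStiffnessCeilingU8b10_le_1o8/FreeCanonicalB8Sketch.lean`: targets `FreeCanonicalRungB8`,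
`FreeCanonicalRungB8Sub s`). With the single-site algebra of `TcThermcert1FreeCanonicalSingleSiteTimeReversal` (§1 sector-diagonality, §2 time reversal), this file settles
**`FreeCanonicalRungB8Sub s` for every `s ≤ 0`** (body form, line-local definitions
unfolded, same convention as the tree's `freeCanonical_rungSubBody_of_neg`), in particular the director's target `FreeCanonicalRungB8Sub 0`.

WHY `s ≤ 0` IS A DEGENERATE RANGE (honest label). For `s ≤ 0` and `L ≥ 2` the support bound `|X| ≤ L^s ≤ 1` leaves `X = ∅` or `X = {x}`.
A single-site even observable `A ∈ CAR⁺(orbSet {x})` commutes with every number operator off `x` (graded locality), so its matrix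
elements inside one `(N↑, N↓)` sector join only EQUAL configurations (the compression `P A P` is DIAGONAL); the free flux-free torus
weight `e^{−βH₀}` and the sector projection are real symmetric matrices while the bond current is `i ×` a real antisymmetric one
(tree: `transpose_current`), so **`ω_p(A j) = 0` identically whenever `x` is off the bond** (time reversal), and `|ω_p(A j)| ≤ ‖A j‖ ≤ 4‖A‖`
when `x` is on the bond (then `d = 0`). Hence `R(s)`, `s ≤ 0`, holds with `ξ = 1`, `C = 4`, `k = 0`, `L₀ = 2` — by finite-dimensional
algebra, WITHOUT the insertion bound S6 or the contour assembly. The genuine content of the scheme (current–current correlations, i.e.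
transpose-ODD even observables such as a current inside `X`) only starts at `|X| ≥ 2`, i.e. `s > 0`; nothing here bears on it.

HONEST LABEL: statements about the FREE (`U = 0`) torus gas; a (degenerate) step of a RUNG (`U = 0`, BC5-type witness for the C8 bet),
reach at `U = 8` ZERO; decides nothing about K1/K1′/`T_c`; superconductivity in the Hubbard model is NOT proved or advanced by this file.
No definitions; no `sorry`.
-/

noncomputable section

namespace Summit.Ventures.CertifiedManyBodySolver.Theorems.TcThermcert1.FreeCanonicalB8

open Matrix Finset
open Literature.MathematicalPhysics.QuantumLattice
open Literature.Probability.LatticeModels (TorusSite)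
open Summit.Ventures.CertifiedManyBodySolver.Theorems.TcThermcert1.FreeGasCurrentClustering
open Summit.Ventures.CertifiedManyBodySolver.Theorems.TcThermcert1.GaugeQbpFarSeam
  (farBond_mem_carEvenSubalgebra commute_of_mem_carEvenSubalgebra_orbSet norm_farBond_le)
open Summit.Ventures.CertifiedManyBodySolver.Theorems.TcThermcert1.ZeroFreeCorridor (card_and_two_mul_card_filter_iff)
open scoped Matrix.Norms.L2Operator ComplexOrder

/-! ## The free flux-free torus: `R(s)` for every `s ≤ 0` -/

section Torus

variable (L : ℕ) [NeZero L]

/-- The free flux-free torus Hamiltonian is a (real) symmetric matrix in the occupation basis. -/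
theorem hubbardTorusTT'Flux_free_transpose : (hubbardTorusTT'Flux L 0 0 0)ᵀ = hubbardTorusTT'Flux L 0 0 0 := by
  rw [hubbardTorusTT'Flux_free_eq_dGamma, dGamma_transpose_eq, hubbardOneBody_torus_transpose]

/-- **Time reversal on the torus, line vocabulary.** For every `β`, every hole density `δ` (sector `(N, N↑) = (2m, m)`, `m = ⌊(1−δ)L²/2⌋`) and
every sector-preserving observable `A` that commutes with the bond current `j_{X₀,y}` and is diagonal between distinct configurations of one sector
(a single-site even observable off the bond `(X₀−1,y)–(X₀,y)`, or a scalar): `ω_p(A j_{X₀,y}) = 0`. -/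
theorem torus_sectorGibbs_mul_bondCurrent_eq_zero (β δ : ℝ) (X₀ y : ZMod L)
    {A : Matrix (Finset (Orb (FermionTorus 2 L))) (Finset (Orb (FermionTorus 2 L))) ℂ}
    (hAJ : A * (∑ σ : Fin 2,
        ((-Complex.I) • (creation (orb (FermionTorus.ofTorusSite (![X₀, y] : TorusSite 2 L)) σ) *
            annihilation (orb (FermionTorus.ofTorusSite (![X₀ - 1, y] : TorusSite 2 L)) σ)) +
          Complex.I • (creation (orb (FermionTorus.ofTorusSite (![X₀ - 1, y] : TorusSite 2 L)) σ) *
            annihilation (orb (FermionTorus.ofTorusSite (![X₀, y] : TorusSite 2 L)) σ)))) =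
      (∑ σ : Fin 2,
        ((-Complex.I) • (creation (orb (FermionTorus.ofTorusSite (![X₀, y] : TorusSite 2 L)) σ) *
            annihilation (orb (FermionTorus.ofTorusSite (![X₀ - 1, y] : TorusSite 2 L)) σ)) +
          Complex.I • (creation (orb (FermionTorus.ofTorusSite (![X₀ - 1, y] : TorusSite 2 L)) σ) *
            annihilation (orb (FermionTorus.ofTorusSite (![X₀, y] : TorusSite 2 L)) σ)))) * A)
    (hAd : ∀ s t : Finset (Orb (FermionTorus 2 L)), s ≠ t → (upPart s).card = (upPart t).card →
      (downPart s).card = (downPart t).card → A s t = 0)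
    (hSP : ∀ s t : Finset (Orb (FermionTorus 2 L)),
      (s.card = 2 * ⌊(1 - δ) * (L : ℝ) ^ 2 / 2⌋₊ ∧ 2 * (s.filter fun i => (ofLex i).2 = 0).card = 2 * ⌊(1 - δ) * (L : ℝ) ^ 2 / 2⌋₊) →
      ¬ (t.card = 2 * ⌊(1 - δ) * (L : ℝ) ^ 2 / 2⌋₊ ∧ 2 * (t.filter fun i => (ofLex i).2 = 0).card = 2 * ⌊(1 - δ) * (L : ℝ) ^ 2 / 2⌋₊) →
      A s t = 0 ∧ A t s = 0) :
    gibbsState β ((hubbardTorusTT'Flux L 0 0 0).toBlock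
        (fun s => s.card = 2 * ⌊(1 - δ) * (L : ℝ) ^ 2 / 2⌋₊ ∧
          2 * (s.filter fun i => (ofLex i).2 = 0).card = 2 * ⌊(1 - δ) * (L : ℝ) ^ 2 / 2⌋₊)
        (fun s => s.card = 2 * ⌊(1 - δ) * (L : ℝ) ^ 2 / 2⌋₊ ∧
          2 * (s.filter fun i => (ofLex i).2 = 0).card = 2 * ⌊(1 - δ) * (L : ℝ) ^ 2 / 2⌋₊))
      ((A * ∑ σ : Fin 2,
        ((-Complex.I) • (creation (orb (FermionTorus.ofTorusSite (![X₀, y] : TorusSite 2 L)) σ) *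
            annihilation (orb (FermionTorus.ofTorusSite (![X₀ - 1, y] : TorusSite 2 L)) σ)) +
          Complex.I • (creation (orb (FermionTorus.ofTorusSite (![X₀ - 1, y] : TorusSite 2 L)) σ) *
            annihilation (orb (FermionTorus.ofTorusSite (![X₀, y] : TorusSite 2 L)) σ)))).toBlock
        (fun s => s.card = 2 * ⌊(1 - δ) * (L : ℝ) ^ 2 / 2⌋₊ ∧
          2 * (s.filter fun i => (ofLex i).2 = 0).card = 2 * ⌊(1 - δ) * (L : ℝ) ^ 2 / 2⌋₊)
        (fun s => s.card = 2 * ⌊(1 - δ) * (L : ℝ) ^ 2 / 2⌋₊ ∧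
          2 * (s.filter fun i => (ofLex i).2 = 0).card = 2 * ⌊(1 - δ) * (L : ℝ) ^ 2 / 2⌋₊)) = 0 := by
  have key := sectorGibbs_mul_current_eq_zero (preservesSectors_hubbardTorusTT'Flux L 0 0 0)
    (hubbardTorusTT'Flux_free_transpose L) β _ (fun s => card_and_two_mul_card_filter_iff s _) _ _ hAJ hAd hSP
  convert key using 4

/-- **States are bounded by the operator norm, line vocabulary**: `‖ω_p(O)‖ ≤ ‖O‖` for the free flux-free torus sector state. -/
theorem torus_norm_sectorGibbs_le (β δ : ℝ) (O : Matrix (Finset (Orb (FermionTorus 2 L))) (Finset (Orb (FermionTorus 2 L))) ℂ) :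
    ‖gibbsState β ((hubbardTorusTT'Flux L 0 0 0).toBlock
        (fun s => s.card = 2 * ⌊(1 - δ) * (L : ℝ) ^ 2 / 2⌋₊ ∧
          2 * (s.filter fun i => (ofLex i).2 = 0).card = 2 * ⌊(1 - δ) * (L : ℝ) ^ 2 / 2⌋₊)
        (fun s => s.card = 2 * ⌊(1 - δ) * (L : ℝ) ^ 2 / 2⌋₊ ∧
          2 * (s.filter fun i => (ofLex i).2 = 0).card = 2 * ⌊(1 - δ) * (L : ℝ) ^ 2 / 2⌋₊))
      (O.toBlock
        (fun s => s.card = 2 * ⌊(1 - δ) * (L : ℝ) ^ 2 / 2⌋₊ ∧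
          2 * (s.filter fun i => (ofLex i).2 = 0).card = 2 * ⌊(1 - δ) * (L : ℝ) ^ 2 / 2⌋₊)
        (fun s => s.card = 2 * ⌊(1 - δ) * (L : ℝ) ^ 2 / 2⌋₊ ∧
          2 * (s.filter fun i => (ofLex i).2 = 0).card = 2 * ⌊(1 - δ) * (L : ℝ) ^ 2 / 2⌋₊))‖ ≤ ‖O‖ := by
  have key := norm_sectorGibbs_toBlock_le (isHermitian_hubbardTorusTT'Flux L 0 0 0) (preservesSectors_hubbardTorusTT'Flux L 0 0 0)
    β (fun s : Finset (Orb (FermionTorus 2 L)) => s.card = 2 * ⌊(1 - δ) * (L : ℝ) ^ 2 / 2⌋₊ ∧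
      2 * (s.filter fun i => (ofLex i).2 = 0).card = 2 * ⌊(1 - δ) * (L : ℝ) ^ 2 / 2⌋₊)
    (fun s => card_and_two_mul_card_filter_iff s ⌊(1 - δ) * (L : ℝ) ^ 2 / 2⌋₊) O
  convert key using 6

/-- On a torus with `L ≥ 2` sites per side, a support with `|X| ≤ L^s`, `s ≤ 0`, has at most one site. -/
theorem card_le_one_of_card_le_rpow_nonpos {L : ℕ} (hL : 2 ≤ L) {s : ℝ} (hs : s ≤ 0) {X : Finset (FermionTorus 2 L)}
    (hX : (X.card : ℝ) ≤ (L : ℝ) ^ s) : X.card ≤ 1 := by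
  have hL1 : (1 : ℝ) ≤ L := by exact_mod_cast (by omega : 1 ≤ L)
  have h1 : (L : ℝ) ^ s ≤ 1 := Real.rpow_le_one_of_one_le_of_nonpos hL1 hs
  exact_mod_cast hX.trans h1

/-- **`R(s)` for every `s ≤ 0` — the body of `FreeCanonicalRungB8Sub s` (sketch `FreeCanonicalB8Sketch.lean`, line-local definitions
`FockOp`, `sectorPred`, `SectorPreserving`, `sectorExpect`, `bondCurrent` unfolded; instantiate by `unfold …; exact`), with
`ξ = 1`, `C = 4`, `k = 0`, `L₀ = 2`.** A support `|X| ≤ L^s ≤ 1` is empty or a single site `x`; for `X = ∅` the observable is a scalar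
(diagonal, commuting with the current) and `ω_p(A j) = 0` by time reversal; for `X = {x}` with `x` off the bond the covariance is `ω_p(A j) − ω_p(A)·0 = ω_p(A j) = 0` by TIME
REVERSAL (`torus_sectorGibbs_mul_bondCurrent_eq_zero`); for `x` on the bond `d = 0` and `|ω_p(A j)| ≤ ‖A j‖ ≤ 4‖A‖`. DEGENERATE range of the ladder (single-site even
sector-preserving observables are transpose-symmetric inside the sector): the ranges `0 < s < 2` and `R` itself remain OPEN and are
exactly where current–current correlations (`|X| ≥ 2`) enter. -/
theorem freeCanonical_rungSubBody_of_nonpos {s : ℝ} (hs : s ≤ 0) :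
    ∃ ξ : ℝ, 0 < ξ ∧ ∃ C : ℝ, ∃ k L₀ : ℕ, ∀ (L : ℕ) [NeZero L], L₀ ≤ L →
      ∀ (X : Finset (FermionTorus 2 L)) (A : Matrix (Finset (Orb (FermionTorus 2 L))) (Finset (Orb (FermionTorus 2 L))) ℂ),
        (X.card : ℝ) ≤ (L : ℝ) ^ s →
        A ∈ carEvenSubalgebra (orbSet X) →
        (∀ s t : Finset (Orb (FermionTorus 2 L)),
          (s.card = 2 * ⌊(1 - (1 - 7 / 8)) * (L : ℝ) ^ 2 / 2⌋₊ ∧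
            2 * (s.filter fun i => (ofLex i).2 = 0).card = 2 * ⌊(1 - (1 - 7 / 8)) * (L : ℝ) ^ 2 / 2⌋₊) →
          ¬ (t.card = 2 * ⌊(1 - (1 - 7 / 8)) * (L : ℝ) ^ 2 / 2⌋₊ ∧
            2 * (t.filter fun i => (ofLex i).2 = 0).card = 2 * ⌊(1 - (1 - 7 / 8)) * (L : ℝ) ^ 2 / 2⌋₊) →
          A s t = 0 ∧ A t s = 0) →
        ∀ (X₀ y : ZMod L) (d : ℕ),
          (∀ x ∈ X, d ≤ torusDist x.toTorusSite ![X₀, y] ∧ d ≤ torusDist x.toTorusSite ![X₀ - 1, y]) →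
          ‖gibbsState 8 ((hubbardTorusTT'Flux L 0 0 0).toBlock
                (fun s => s.card = 2 * ⌊(1 - (1 - 7 / 8)) * (L : ℝ) ^ 2 / 2⌋₊ ∧
                  2 * (s.filter fun i => (ofLex i).2 = 0).card = 2 * ⌊(1 - (1 - 7 / 8)) * (L : ℝ) ^ 2 / 2⌋₊)
                (fun s => s.card = 2 * ⌊(1 - (1 - 7 / 8)) * (L : ℝ) ^ 2 / 2⌋₊ ∧
                  2 * (s.filter fun i => (ofLex i).2 = 0).card = 2 * ⌊(1 - (1 - 7 / 8)) * (L : ℝ) ^ 2 / 2⌋₊))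
              ((A * (∑ σ : Fin 2,
                ((-Complex.I) • (creation (orb (FermionTorus.ofTorusSite (![X₀, y] : TorusSite 2 L)) σ) *
                    annihilation (orb (FermionTorus.ofTorusSite (![X₀ - 1, y] : TorusSite 2 L)) σ)) +
                  Complex.I • (creation (orb (FermionTorus.ofTorusSite (![X₀ - 1, y] : TorusSite 2 L)) σ) *
                    annihilation (orb (FermionTorus.ofTorusSite (![X₀, y] : TorusSite 2 L)) σ))))).toBlock
                (fun s => s.card = 2 * ⌊(1 - (1 - 7 / 8)) * (L : ℝ) ^ 2 / 2⌋₊ ∧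
                  2 * (s.filter fun i => (ofLex i).2 = 0).card = 2 * ⌊(1 - (1 - 7 / 8)) * (L : ℝ) ^ 2 / 2⌋₊)
                (fun s => s.card = 2 * ⌊(1 - (1 - 7 / 8)) * (L : ℝ) ^ 2 / 2⌋₊ ∧
                  2 * (s.filter fun i => (ofLex i).2 = 0).card = 2 * ⌊(1 - (1 - 7 / 8)) * (L : ℝ) ^ 2 / 2⌋₊))
            - gibbsState 8 ((hubbardTorusTT'Flux L 0 0 0).toBlock
                (fun s => s.card = 2 * ⌊(1 - (1 - 7 / 8)) * (L : ℝ) ^ 2 / 2⌋₊ ∧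
                  2 * (s.filter fun i => (ofLex i).2 = 0).card = 2 * ⌊(1 - (1 - 7 / 8)) * (L : ℝ) ^ 2 / 2⌋₊)
                (fun s => s.card = 2 * ⌊(1 - (1 - 7 / 8)) * (L : ℝ) ^ 2 / 2⌋₊ ∧
                  2 * (s.filter fun i => (ofLex i).2 = 0).card = 2 * ⌊(1 - (1 - 7 / 8)) * (L : ℝ) ^ 2 / 2⌋₊))
              (A.toBlock
                (fun s => s.card = 2 * ⌊(1 - (1 - 7 / 8)) * (L : ℝ) ^ 2 / 2⌋₊ ∧
                  2 * (s.filter fun i => (ofLex i).2 = 0).card = 2 * ⌊(1 - (1 - 7 / 8)) * (L : ℝ) ^ 2 / 2⌋₊)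
                (fun s => s.card = 2 * ⌊(1 - (1 - 7 / 8)) * (L : ℝ) ^ 2 / 2⌋₊ ∧
                  2 * (s.filter fun i => (ofLex i).2 = 0).card = 2 * ⌊(1 - (1 - 7 / 8)) * (L : ℝ) ^ 2 / 2⌋₊))
              * gibbsState 8 ((hubbardTorusTT'Flux L 0 0 0).toBlock
                (fun s => s.card = 2 * ⌊(1 - (1 - 7 / 8)) * (L : ℝ) ^ 2 / 2⌋₊ ∧
                  2 * (s.filter fun i => (ofLex i).2 = 0).card = 2 * ⌊(1 - (1 - 7 / 8)) * (L : ℝ) ^ 2 / 2⌋₊)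
                (fun s => s.card = 2 * ⌊(1 - (1 - 7 / 8)) * (L : ℝ) ^ 2 / 2⌋₊ ∧
                  2 * (s.filter fun i => (ofLex i).2 = 0).card = 2 * ⌊(1 - (1 - 7 / 8)) * (L : ℝ) ^ 2 / 2⌋₊))
              ((∑ σ : Fin 2,
                ((-Complex.I) • (creation (orb (FermionTorus.ofTorusSite (![X₀, y] : TorusSite 2 L)) σ) *
                    annihilation (orb (FermionTorus.ofTorusSite (![X₀ - 1, y] : TorusSite 2 L)) σ)) +
                  Complex.I • (creation (orb (FermionTorus.ofTorusSite (![X₀ - 1, y] : TorusSite 2 L)) σ) *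
                    annihilation (orb (FermionTorus.ofTorusSite (![X₀, y] : TorusSite 2 L)) σ)))).toBlock
                (fun s => s.card = 2 * ⌊(1 - (1 - 7 / 8)) * (L : ℝ) ^ 2 / 2⌋₊ ∧
                  2 * (s.filter fun i => (ofLex i).2 = 0).card = 2 * ⌊(1 - (1 - 7 / 8)) * (L : ℝ) ^ 2 / 2⌋₊)
                (fun s => s.card = 2 * ⌊(1 - (1 - 7 / 8)) * (L : ℝ) ^ 2 / 2⌋₊ ∧
                  2 * (s.filter fun i => (ofLex i).2 = 0).card = 2 * ⌊(1 - (1 - 7 / 8)) * (L : ℝ) ^ 2 / 2⌋₊))‖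
            ≤ C * ‖A‖ * (X.card : ℝ) ^ k * Real.exp (-(d : ℝ) / ξ) := by
  refine ⟨1, one_pos, 4, 0, 2, fun L _ hL X A hX hA hSP X₀ y d hd => ?_⟩
  have hj := torus_sectorGibbs_bondCurrent_eq_zero L 8 (1 - 7 / 8) X₀ y
  rw [hj, mul_zero, sub_zero, pow_zero, mul_one]
  have hX1 := card_le_one_of_card_le_rpow_nonpos hL hs hX
  rcases Nat.lt_or_ge X.card 1 with h0 | h1
  · -- `X = ∅`: `A` is a scalar `c • 1`, which commutes with the current and is diagonal — time reversal applies
    have hXe : X = ∅ := Finset.card_eq_zero.1 (by omega)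
    have horb : orbSet (∅ : Finset (FermionTorus 2 L)) = ∅ := by
      ext k; simp [mem_orbSet]
    rw [hXe, horb] at hA
    obtain ⟨c, hc⟩ := scalar_of_mem_carEvenSubalgebra_empty hA
    have hA1 : A = c • (1 : Matrix (Finset (Orb (FermionTorus 2 L))) (Finset (Orb (FermionTorus 2 L))) ℂ) := by
      ext s t
      rw [hc s t, Matrix.smul_apply, Matrix.one_apply, smul_eq_mul]
      split_ifs <;> simp
    have hAJ := fun (J : Matrix (Finset (Orb (FermionTorus 2 L))) (Finset (Orb (FermionTorus 2 L))) ℂ) =>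
      show A * J = J * A by rw [hA1, Matrix.smul_mul, Matrix.mul_smul, Matrix.one_mul, Matrix.mul_one]
    have hAd : ∀ s t : Finset (Orb (FermionTorus 2 L)), s ≠ t → (upPart s).card = (upPart t).card →
        (downPart s).card = (downPart t).card → A s t = 0 := fun s t hst _ _ => by
      rw [hc s t, if_neg hst]
    rw [torus_sectorGibbs_mul_bondCurrent_eq_zero L 8 (1 - 7 / 8) X₀ y (hAJ _) hAd hSP, norm_zero]
    positivity
  · -- `X = {x}`
    obtain ⟨x, hXx⟩ := Finset.card_eq_one.1 (le_antisymm hX1 h1)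
    rw [hXx] at hA hd
    have h4 := norm_farBond_le (FermionTorus.ofTorusSite (![X₀, y] : TorusSite 2 L))
      (FermionTorus.ofTorusSite (![X₀ - 1, y] : TorusSite 2 L))
    have hAn := norm_nonneg A
    by_cases hxa : x = FermionTorus.ofTorusSite (![X₀, y] : TorusSite 2 L)
    · -- on the bond: `d = 0`, crude bound `‖ω_p(A j)‖ ≤ ‖A j‖ ≤ 4‖A‖`
      have hd0 : d = 0 := by
        have h := (hd x (Finset.mem_singleton_self x)).1
        rw [hxa, FermionTorus.toTorusSite_ofTorusSite, torusDist_self] at h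
        exact Nat.le_zero.1 h
      rw [hd0, Nat.cast_zero, neg_zero, zero_div, Real.exp_zero, mul_one]
      refine (torus_norm_sectorGibbs_le L 8 (1 - 7 / 8) _).trans ((norm_mul_le _ _).trans ?_)
      exact (mul_le_mul_of_nonneg_left h4 hAn).trans_eq (mul_comm _ _)
    by_cases hxb : x = FermionTorus.ofTorusSite (![X₀ - 1, y] : TorusSite 2 L)
    · have hd0 : d = 0 := by
        have h := (hd x (Finset.mem_singleton_self x)).2
        rw [hxb, FermionTorus.toTorusSite_ofTorusSite, torusDist_self] at h
        exact Nat.le_zero.1 h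
      rw [hd0, Nat.cast_zero, neg_zero, zero_div, Real.exp_zero, mul_one]
      refine (torus_norm_sectorGibbs_le L 8 (1 - 7 / 8) _).trans ((norm_mul_le _ _).trans ?_)
      exact (mul_le_mul_of_nonneg_left h4 hAn).trans_eq (mul_comm _ _)
    -- off the bond: graded locality + time reversal
    have hAJ := (commute_of_mem_carEvenSubalgebra_orbSet hA
      (farBond_mem_carEvenSubalgebra
        (X := ({FermionTorus.ofTorusSite (![X₀, y] : TorusSite 2 L), FermionTorus.ofTorusSite (![X₀ - 1, y] : TorusSite 2 L)} :
          Finset (FermionTorus 2 L)))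
        (a := FermionTorus.ofTorusSite (![X₀, y] : TorusSite 2 L)) (b := FermionTorus.ofTorusSite (![X₀ - 1, y] : TorusSite 2 L))
        (Finset.mem_insert_self _ _) (Finset.mem_insert_of_mem (Finset.mem_singleton_self _)))
      (Finset.disjoint_singleton_left.2 (by
        simp only [Finset.mem_insert, Finset.mem_singleton, hxa, hxb, or_self, not_false_eq_true]))).eq
    have hAd : ∀ s t : Finset (Orb (FermionTorus 2 L)), s ≠ t → (upPart s).card = (upPart t).card →
        (downPart s).card = (downPart t).card → A s t = 0 :=
      fun s t hst hu hd' => apply_eq_zero_of_mem_carEvenSubalgebra_singleton hA hst hu hd'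
    rw [torus_sectorGibbs_mul_bondCurrent_eq_zero L 8 (1 - 7 / 8) X₀ y hAJ hAd hSP, norm_zero]
    positivity

/-- **`R(0)` = `FreeCanonicalRungB8Sub 0` (body form; the director's target for this hand).** The `s = 0` instance of
`freeCanonical_rungSubBody_of_nonpos`: supports with `|X| ≤ L^0 = 1`. Degenerate range — see the file header for the honest label. -/
theorem freeCanonical_rungSubBody_zero :
    ∃ ξ : ℝ, 0 < ξ ∧ ∃ C : ℝ, ∃ k L₀ : ℕ, ∀ (L : ℕ) [NeZero L], L₀ ≤ L →
      ∀ (X : Finset (FermionTorus 2 L)) (A : Matrix (Finset (Orb (FermionTorus 2 L))) (Finset (Orb (FermionTorus 2 L))) ℂ),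
        (X.card : ℝ) ≤ (L : ℝ) ^ (0 : ℝ) →
        A ∈ carEvenSubalgebra (orbSet X) →
        (∀ s t : Finset (Orb (FermionTorus 2 L)),
          (s.card = 2 * ⌊(1 - (1 - 7 / 8)) * (L : ℝ) ^ 2 / 2⌋₊ ∧
            2 * (s.filter fun i => (ofLex i).2 = 0).card = 2 * ⌊(1 - (1 - 7 / 8)) * (L : ℝ) ^ 2 / 2⌋₊) →
          ¬ (t.card = 2 * ⌊(1 - (1 - 7 / 8)) * (L : ℝ) ^ 2 / 2⌋₊ ∧
            2 * (t.filter fun i => (ofLex i).2 = 0).card = 2 * ⌊(1 - (1 - 7 / 8)) * (L : ℝ) ^ 2 / 2⌋₊) →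
          A s t = 0 ∧ A t s = 0) →
        ∀ (X₀ y : ZMod L) (d : ℕ),
          (∀ x ∈ X, d ≤ torusDist x.toTorusSite ![X₀, y] ∧ d ≤ torusDist x.toTorusSite ![X₀ - 1, y]) →
          ‖gibbsState 8 ((hubbardTorusTT'Flux L 0 0 0).toBlock
                (fun s => s.card = 2 * ⌊(1 - (1 - 7 / 8)) * (L : ℝ) ^ 2 / 2⌋₊ ∧
                  2 * (s.filter fun i => (ofLex i).2 = 0).card = 2 * ⌊(1 - (1 - 7 / 8)) * (L : ℝ) ^ 2 / 2⌋₊)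
                (fun s => s.card = 2 * ⌊(1 - (1 - 7 / 8)) * (L : ℝ) ^ 2 / 2⌋₊ ∧
                  2 * (s.filter fun i => (ofLex i).2 = 0).card = 2 * ⌊(1 - (1 - 7 / 8)) * (L : ℝ) ^ 2 / 2⌋₊))
              ((A * (∑ σ : Fin 2,
                ((-Complex.I) • (creation (orb (FermionTorus.ofTorusSite (![X₀, y] : TorusSite 2 L)) σ) *
                    annihilation (orb (FermionTorus.ofTorusSite (![X₀ - 1, y] : TorusSite 2 L)) σ)) +
                  Complex.I • (creation (orb (FermionTorus.ofTorusSite (![X₀ - 1, y] : TorusSite 2 L)) σ) *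
                    annihilation (orb (FermionTorus.ofTorusSite (![X₀, y] : TorusSite 2 L)) σ))))).toBlock
                (fun s => s.card = 2 * ⌊(1 - (1 - 7 / 8)) * (L : ℝ) ^ 2 / 2⌋₊ ∧
                  2 * (s.filter fun i => (ofLex i).2 = 0).card = 2 * ⌊(1 - (1 - 7 / 8)) * (L : ℝ) ^ 2 / 2⌋₊)
                (fun s => s.card = 2 * ⌊(1 - (1 - 7 / 8)) * (L : ℝ) ^ 2 / 2⌋₊ ∧
                  2 * (s.filter fun i => (ofLex i).2 = 0).card = 2 * ⌊(1 - (1 - 7 / 8)) * (L : ℝ) ^ 2 / 2⌋₊))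
            - gibbsState 8 ((hubbardTorusTT'Flux L 0 0 0).toBlock
                (fun s => s.card = 2 * ⌊(1 - (1 - 7 / 8)) * (L : ℝ) ^ 2 / 2⌋₊ ∧
                  2 * (s.filter fun i => (ofLex i).2 = 0).card = 2 * ⌊(1 - (1 - 7 / 8)) * (L : ℝ) ^ 2 / 2⌋₊)
                (fun s => s.card = 2 * ⌊(1 - (1 - 7 / 8)) * (L : ℝ) ^ 2 / 2⌋₊ ∧
                  2 * (s.filter fun i => (ofLex i).2 = 0).card = 2 * ⌊(1 - (1 - 7 / 8)) * (L : ℝ) ^ 2 / 2⌋₊))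
              (A.toBlock
                (fun s => s.card = 2 * ⌊(1 - (1 - 7 / 8)) * (L : ℝ) ^ 2 / 2⌋₊ ∧
                  2 * (s.filter fun i => (ofLex i).2 = 0).card = 2 * ⌊(1 - (1 - 7 / 8)) * (L : ℝ) ^ 2 / 2⌋₊)
                (fun s => s.card = 2 * ⌊(1 - (1 - 7 / 8)) * (L : ℝ) ^ 2 / 2⌋₊ ∧
                  2 * (s.filter fun i => (ofLex i).2 = 0).card = 2 * ⌊(1 - (1 - 7 / 8)) * (L : ℝ) ^ 2 / 2⌋₊))
              * gibbsState 8 ((hubbardTorusTT'Flux L 0 0 0).toBlock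
                (fun s => s.card = 2 * ⌊(1 - (1 - 7 / 8)) * (L : ℝ) ^ 2 / 2⌋₊ ∧
                  2 * (s.filter fun i => (ofLex i).2 = 0).card = 2 * ⌊(1 - (1 - 7 / 8)) * (L : ℝ) ^ 2 / 2⌋₊)
                (fun s => s.card = 2 * ⌊(1 - (1 - 7 / 8)) * (L : ℝ) ^ 2 / 2⌋₊ ∧
                  2 * (s.filter fun i => (ofLex i).2 = 0).card = 2 * ⌊(1 - (1 - 7 / 8)) * (L : ℝ) ^ 2 / 2⌋₊))
              ((∑ σ : Fin 2,
                ((-Complex.I) • (creation (orb (FermionTorus.ofTorusSite (![X₀, y] : TorusSite 2 L)) σ) *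
                    annihilation (orb (FermionTorus.ofTorusSite (![X₀ - 1, y] : TorusSite 2 L)) σ)) +
                  Complex.I • (creation (orb (FermionTorus.ofTorusSite (![X₀ - 1, y] : TorusSite 2 L)) σ) *
                    annihilation (orb (FermionTorus.ofTorusSite (![X₀, y] : TorusSite 2 L)) σ)))).toBlock
                (fun s => s.card = 2 * ⌊(1 - (1 - 7 / 8)) * (L : ℝ) ^ 2 / 2⌋₊ ∧
                  2 * (s.filter fun i => (ofLex i).2 = 0).card = 2 * ⌊(1 - (1 - 7 / 8)) * (L : ℝ) ^ 2 / 2⌋₊)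
                (fun s => s.card = 2 * ⌊(1 - (1 - 7 / 8)) * (L : ℝ) ^ 2 / 2⌋₊ ∧
                  2 * (s.filter fun i => (ofLex i).2 = 0).card = 2 * ⌊(1 - (1 - 7 / 8)) * (L : ℝ) ^ 2 / 2⌋₊))‖
            ≤ C * ‖A‖ * (X.card : ℝ) ^ k * Real.exp (-(d : ℝ) / ξ) :=
  freeCanonical_rungSubBody_of_nonpos le_rfl

end Torus

end Summit.Ventures.CertifiedManyBodySolver.Theorems.TcThermcert1.FreeCanonicalB8

end
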